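import Literature.Analysis.PDE.CoordWordDeriv
import Literature.Analysis.Calculus.JointSmoothnessPartials
import Mathlib.Analysis.Calculus.UniformLimitsDeriv
import HarnessLib

/-!
# Uniform limits of smooth maps through coordinate word derivatives, and joint smoothness from
# word partials (topic `Analysis/PDE`)

Analysis/PDE support file (everything proved; no definitions, no named facts). Two classical
tools by which approximation schemes for evolution equations deliver classical `C^∞` solutions
(used for the Picard scheme of quasilinear symmetric hyperbolic systems on `𝕋³`, Majda 1984,
Ch. 2, proof of Thm 2.1, Step 3; Dafermos 2005, §5.1 (5.1.25)–(5.1.26)), phrased with the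
coordinate word derivatives `cwd v` of `CoordWordDeriv`:

* `exists_limit_of_uniformly_cauchy_cwd` — **uniform limits**: if `f k τ : ℝⁿ → F` are smooth
  and for every word `v` the family `cwd v (f k τ)` is uniformly Cauchy in `(τ, y) ∈ S × ℝⁿ`,
  then there are limit fields `g v τ` with `cwd v (f k τ) → g v τ` uniformly on `S × ℝⁿ`, and
  every `g v τ` is differentiable with `D(g v τ)(y) h = Σᵢ hᵢ g (i :: v) τ y` (Mathlib's
  `hasFDerivAt_of_tendstoUniformly`; Rudin, *Principles*, Thm 7.17);
* `contDiffOn_of_word_partials` — **joint smoothness from word partials**: a family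
  `G l v : I × ℝⁿ → F` (`I ⊆ ℝ` open; think `G l v = ∂ₜˡ ∂^v u`) in which every member is
  jointly continuous, has `y`-derivative `h ↦ Σᵢ hᵢ G l (i :: v)` and `t`-derivative
  `G (l+1) v`, consists of jointly `C^∞` maps (induction on the order through the tree's
  `contDiffOn_succ_of_partial`; Dieudonné (8.12)).

## Mathlib / tree search

Mathlib: `hasFDerivAt_of_tendstoUniformly`, `hasDerivAt_of_tendstoUniformlyOn`,
`tendsto_nhds_limUnder`, `Metric.cauchySeq_iff`. Tree: `contDiffOn_succ_of_partial`,
`contDiffOn_uncurry_of_mixed_partials` (`JointSmoothnessPartials`, the latter in the currency of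
full iterated derivatives), `cwd`, `bv` (`CoordWordDeriv`).

## References

* W. Rudin, *Principles of Mathematical Analysis*, 3rd ed., Thm 7.17. [folklore]
* J. Dieudonné, *Foundations of Modern Analysis*, Academic Press 1960, (8.9.1), (8.12).
  [folklore]
* A. Majda, *Compressible Fluid Flow and Systems of Conservation Laws in Several Space
  Variables*, Springer 1984, Ch. 2 §2.1, proof of Thm 2.1, Step 3. [`Majda1984`]
-/

noncomputable section

open Set Function Filter Topology
open scoped ContDiff Topology

namespace Literature.Analysis.PDE

variable {ι : Type*} [Fintype ι] [DecidableEq ι]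
variable {F : Type*} [NormedAddCommGroup F] [NormedSpace ℝ F]

/-! ## Coordinates -/

omit [DecidableEq ι] in
/-- The coordinate projections have operator norm at most one. [folklore] -/
theorem norm_proj_le_one (i : ι) : ‖(EuclideanSpace.proj i : EuclideanSpace ℝ ι →L[ℝ] ℝ)‖ ≤ 1 :=
  ContinuousLinearMap.opNorm_le_bound _ zero_le_one fun h => by
    simpa using PiLp.norm_apply_le (p := 2) h i

omit [DecidableEq ι] in
/-- **The Fréchet derivative through the coordinate partials**:
`Dφ(y) = Σᵢ prᵢ ⊗ ∂ᵢφ(y)`, i.e. `Dφ(y) h = Σᵢ hᵢ ∂ᵢφ(y)`. [folklore] -/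
theorem fderiv_eq_sum_proj_smulRight (φ : EuclideanSpace ℝ ι → F) (y : EuclideanSpace ℝ ι) :
    fderiv ℝ φ y = ∑ i, (EuclideanSpace.proj i).smulRight (fderiv ℝ φ y (bv i)) := by
  ext h
  conv_lhs => rw [← (EuclideanSpace.basisFun ι ℝ).sum_repr h]
  simp only [map_sum, map_smul, FunLike.coe_sum, Finset.sum_apply,
    ContinuousLinearMap.smulRight_apply, EuclideanSpace.basisFun_repr, bv_def]
  rfl

omit [DecidableEq ι] in
/-- Norm bound for coordinate-assembled linear maps: `‖Σᵢ prᵢ ⊗ zᵢ‖ ≤ Σᵢ ‖zᵢ‖`. [folklore] -/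
theorem norm_sum_proj_smulRight_le (z : ι → F) :
    ‖∑ i, (EuclideanSpace.proj i : EuclideanSpace ℝ ι →L[ℝ] ℝ).smulRight (z i)‖ ≤ ∑ i, ‖z i‖ := by
  refine (norm_sum_le _ _).trans (Finset.sum_le_sum fun i _ => ?_)
  rw [ContinuousLinearMap.norm_smulRight_apply]
  exact mul_le_of_le_one_left (norm_nonneg _) (norm_proj_le_one i)

/-! ## Uniform limits through word derivatives -/

section Limits

variable [CompleteSpace F]

omit [DecidableEq ι] in
/-- **Uniform limits of smooth maps with uniformly Cauchy word derivatives** (Rudin, Thm 7.17,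
iterated along coordinate words): let `f k τ : ℝⁿ → F` be smooth for all `k` and all parameters
`τ`, and suppose that for every word `v` the family `(k, τ, y) ↦ cwd v (f k τ) y` is uniformly
Cauchy on `S × ℝⁿ`. Then there are `g v τ : ℝⁿ → F` with `cwd v (f k τ) → g v τ` uniformly on
`S × ℝⁿ` for every `v`, `f k τ y → g [] τ y`, and for `τ ∈ S` every `g v τ` has the Fréchet
derivative `h ↦ Σᵢ hᵢ g (i :: v) τ y` at every `y`. [folklore] -/
theorem exists_limit_of_uniformly_cauchy_cwd {P : Type*} (S : Set P)
    {f : ℕ → P → EuclideanSpace ℝ ι → F} (hf : ∀ k τ, ContDiff ℝ ∞ (f k τ))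
    (hC : ∀ v : List ι, ∀ ε > (0 : ℝ), ∃ N : ℕ, ∀ k, N ≤ k → ∀ k', N ≤ k' → ∀ τ ∈ S, ∀ y,
      ‖cwd v (f k τ) y - cwd v (f k' τ) y‖ ≤ ε) :
    ∃ g : List ι → P → EuclideanSpace ℝ ι → F,
      (∀ v : List ι, ∀ ε > (0 : ℝ), ∃ N : ℕ, ∀ k, N ≤ k → ∀ τ ∈ S, ∀ y,
        ‖cwd v (f k τ) y - g v τ y‖ ≤ ε) ∧
      (∀ v : List ι, ∀ τ ∈ S, ∀ y, Tendsto (fun k => cwd v (f k τ) y) atTop (𝓝 (g v τ y))) ∧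
      (∀ v : List ι, ∀ τ ∈ S, ∀ y,
        HasFDerivAt (g v τ)
          (∑ i, (EuclideanSpace.proj i : EuclideanSpace ℝ ι →L[ℝ] ℝ).smulRight (g (i :: v) τ y)) y) := by
  -- pointwise limits
  set g : List ι → P → EuclideanSpace ℝ ι → F := fun v τ y => limUnder atTop fun k => cwd v (f k τ) y
    with hg
  have hconv : ∀ v, ∀ τ ∈ S, ∀ y, Tendsto (fun k => cwd v (f k τ) y) atTop (𝓝 (g v τ y)) := by
    intro v τ hτ y
    refine tendsto_nhds_limUnder (cauchySeq_tendsto_of_complete ?_)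
    refine Metric.cauchySeq_iff.2 fun ε hε => ?_
    obtain ⟨N, hN⟩ := hC v (ε / 2) (by positivity)
    exact ⟨N, fun m hm n hn => by
      rw [dist_eq_norm]; exact (hN m hm n hn τ hτ y).trans_lt (by linarith)⟩
  have hunif : ∀ v : List ι, ∀ ε > (0 : ℝ), ∃ N : ℕ, ∀ k, N ≤ k → ∀ τ ∈ S, ∀ y,
      ‖cwd v (f k τ) y - g v τ y‖ ≤ ε := by
    intro v ε hε
    obtain ⟨N, hN⟩ := hC v ε hε
    refine ⟨N, fun k hk τ hτ y => ?_⟩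
    have hlim : Tendsto (fun k' => ‖cwd v (f k τ) y - cwd v (f k' τ) y‖) atTop
        (𝓝 ‖cwd v (f k τ) y - g v τ y‖) :=
      ((tendsto_const_nhds.sub (hconv v τ hτ y)).norm)
    exact le_of_tendsto hlim (eventually_atTop.2 ⟨N, fun k' hk' => hN k hk k' hk' τ hτ y⟩)
  refine ⟨g, hunif, hconv, fun v τ hτ y => ?_⟩
  -- derivative of the limit
  have hfd : ∀ n (z : EuclideanSpace ℝ ι), HasFDerivAt (cwd v (f n τ)) (fderiv ℝ (cwd v (f n τ)) z) z :=
    fun n z => ((differentiable_cwd (hf n τ) v) z).hasFDerivAt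
  refine hasFDerivAt_of_tendstoUniformly (l := atTop)
    (g' := fun z => ∑ i, (EuclideanSpace.proj i : EuclideanSpace ℝ ι →L[ℝ] ℝ).smulRight (g (i :: v) τ z))
    ?_ hfd (hconv v τ hτ) y
  refine Metric.tendstoUniformly_iff.2 fun ε hε => ?_
  have hcard : (0 : ℝ) < Fintype.card ι + 1 := by positivity
  choose N hN using fun i : ι => hunif (i :: v) (ε / (Fintype.card ι + 1)) (by positivity)
  refine eventually_atTop.2 ⟨Finset.univ.sup N, fun n hn z => ?_⟩
  rw [dist_comm, dist_eq_norm, fderiv_eq_sum_proj_smulRight]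
  have heq : ∑ i, (EuclideanSpace.proj i : EuclideanSpace ℝ ι →L[ℝ] ℝ).smulRight
        (fderiv ℝ (cwd v (f n τ)) z (bv i)) -
      ∑ i, (EuclideanSpace.proj i : EuclideanSpace ℝ ι →L[ℝ] ℝ).smulRight (g (i :: v) τ z) =
      ∑ i, (EuclideanSpace.proj i : EuclideanSpace ℝ ι →L[ℝ] ℝ).smulRight
        (fderiv ℝ (cwd v (f n τ)) z (bv i) - g (i :: v) τ z) := by
    rw [← Finset.sum_sub_distrib]
    refine Finset.sum_congr rfl fun i _ => ?_
    ext h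
    simp only [FunLike.coe_sub, Pi.sub_apply, ContinuousLinearMap.smulRight_apply, smul_sub]
  rw [heq]
  have hn' : ∀ i, N i ≤ n := fun i => (Finset.le_sup (Finset.mem_univ i)).trans hn
  calc ‖∑ i, (EuclideanSpace.proj i : EuclideanSpace ℝ ι →L[ℝ] ℝ).smulRight
          (fderiv ℝ (cwd v (f n τ)) z (bv i) - g (i :: v) τ z)‖
      ≤ ∑ i, ‖fderiv ℝ (cwd v (f n τ)) z (bv i) - g (i :: v) τ z‖ := norm_sum_proj_smulRight_le _
    _ ≤ ∑ _i : ι, ε / (Fintype.card ι + 1) :=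
        Finset.sum_le_sum fun i _ => hN i n (hn' i) τ hτ z
    _ = Fintype.card ι * (ε / (Fintype.card ι + 1)) := by simp
    _ < ε := by
        rw [← mul_div_assoc, div_lt_iff₀ hcard]
        nlinarith

end Limits

/-! ## Joint smoothness from word partials -/

omit [DecidableEq ι] in
/-- **Joint `C^∞` smoothness from the family of word partials.** Let `I ⊆ ℝ` be open and
`G l v : ℝ × ℝⁿ → F` (`l ∈ ℕ`, `v` a word; think `G l v = ∂ₜˡ∂^v u`) be such that on `I × ℝⁿ`
every `G l v` is continuous, `y ↦ G l v (t, y)` has the Fréchet derivative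
`h ↦ Σᵢ hᵢ G l (i :: v) (t, y)`, and `τ ↦ G l v (τ, y)` has the derivative `G (l+1) v (t, y)`.
Then every `G l v` is `C^∞` on `I × ℝⁿ` (induction on the order of differentiability for all
`l, v` at once, through `contDiffOn_succ_of_partial`). (Dieudonné (8.12).) [folklore] -/
theorem contDiffOn_of_word_partials {I : Set ℝ} (hI : IsOpen I)
    {G : ℕ → List ι → ℝ × EuclideanSpace ℝ ι → F}
    (hy : ∀ l v, ∀ p ∈ I ×ˢ (univ : Set (EuclideanSpace ℝ ι)),
      HasFDerivAt (fun y => G l v (p.1, y))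
        (∑ i, (EuclideanSpace.proj i : EuclideanSpace ℝ ι →L[ℝ] ℝ).smulRight (G l (i :: v) p)) p.2)
    (ht : ∀ l v, ∀ p ∈ I ×ˢ (univ : Set (EuclideanSpace ℝ ι)),
      HasDerivAt (fun τ => G l v (τ, p.2)) (G (l + 1) v p) p.1)
    (hc : ∀ l v, ContinuousOn (G l v) (I ×ˢ univ)) (l : ℕ) (v : List ι) :
    ContDiffOn ℝ ∞ (G l v) (I ×ˢ univ) := by
  have hU : IsOpen (I ×ˢ (univ : Set (EuclideanSpace ℝ ι))) := hI.prod isOpen_univ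
  suffices h : ∀ n : ℕ, ∀ l v, ContDiffOn ℝ n (G l v) (I ×ˢ univ) by
    rw [contDiffOn_infty]
    exact fun n => h n l v
  intro n
  induction n with
  | zero => intro l v; exact contDiffOn_zero.2 (hc l v)
  | succ n ih =>
    intro l v
    have hA : ∀ p ∈ I ×ˢ (univ : Set (EuclideanSpace ℝ ι)),
        HasFDerivAt (fun a : ℝ => G l v (a, p.2)) ((1 : ℝ →L[ℝ] ℝ).smulRight (G (l + 1) v p)) p.1 :=
      fun p hp => (ht l v p hp).hasFDerivAt
    have hAc : ContDiffOn ℝ n (fun p => (1 : ℝ →L[ℝ] ℝ).smulRight (G (l + 1) v p)) (I ×ˢ univ) :=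
      contDiffOn_const.smulRight (ih (l + 1) v)
    have hBc : ContDiffOn ℝ n (fun p => ∑ i,
        (EuclideanSpace.proj i : EuclideanSpace ℝ ι →L[ℝ] ℝ).smulRight (G l (i :: v) p)) (I ×ˢ univ) :=
      ContDiffOn.sum fun i _ => contDiffOn_const.smulRight (ih l (i :: v))
    have h := Literature.Analysis.Calculus.contDiffOn_succ_of_partial hU hA (hy l v) hAc hBc
    exact_mod_cast h

/-- **Time derivatives of uniform limits** (the one-variable input, Mathlib's
`hasDerivAt_of_tendstoUniformlyOn` on an open time set, in `ε`-`N` form): if `φ k : ℝ → F`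
have derivatives `ψ k` on the open set `I`, `ψ k → ψ∞` uniformly on `I` and `φ k → φ∞`
pointwise on `I`, then `φ∞` has derivative `ψ∞` on `I`. [folklore] -/
theorem hasDerivAt_of_uniform_approx {F' : Type*} [NormedAddCommGroup F'] [NormedSpace ℝ F']
    {I : Set ℝ} (hI : IsOpen I) {φ : ℕ → ℝ → F'} {ψ : ℕ → ℝ → F'} {φl ψl : ℝ → F'}
    (hder : ∀ k, ∀ t ∈ I, HasDerivAt (φ k) (ψ k t) t)
    (hψ : ∀ ε > (0 : ℝ), ∃ N : ℕ, ∀ k, N ≤ k → ∀ t ∈ I, ‖ψ k t - ψl t‖ ≤ ε)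
    (hφ : ∀ t ∈ I, Tendsto (fun k => φ k t) atTop (𝓝 (φl t))) {t : ℝ} (ht : t ∈ I) :
    HasDerivAt φl (ψl t) t := by
  refine hasDerivAt_of_tendstoUniformlyOn hI ?_ (Eventually.of_forall hder) hφ ht
  refine Metric.tendstoUniformlyOn_iff.2 fun ε hε => ?_
  obtain ⟨N, hN⟩ := hψ (ε / 2) (by positivity)
  refine eventually_atTop.2 ⟨N, fun k hk s hs => ?_⟩
  rw [dist_comm, dist_eq_norm]
  exact (hN k hk s hs).trans_lt (by linarith)

end Literature.Analysis.PDE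

end
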